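import Literature.NumberTheory.Rogawski1990.LocalStableClassesNonsplitKappaCount          -- ★ p840588 `finsum_mem_conjClassesIn_finKappaAt_out_eq_zero` (κ_v two–two on the four classes)
import Literature.NumberTheory.Rogawski1990.UnitFundamentalLemmaInertSplitClauseOfValues   -- ★ F12 `mk_mem_conjClassesIn_of_isLocalNormPair` (+ ★ `…IrredClauseOfValues`: `isLocalNormPair_of_mk_mem_conjClassesIn`)
import Literature.NumberTheory.Rogawski1990.FinExplicitTransferFactorTorusDockSplit        -- ★ p842204 §1 `val_endoGL_frame_conj`, §3 `eval_finCharpolyTwo_eq_of_frame`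
import Literature.NumberTheory.Rogawski1990.FinExplicitTransferFactorNondegenerate         -- ★ `isUnit_eval_finCharpolyTwo_of_isLocalGRegular`
import Literature.NumberTheory.Rogawski1990.UnitaryRankTwoFrameAlgebra                     -- ★ `gram_offDiag_eq_zero`, `norm_diag_eq_one_of_gram`, `mul_frame_eq_frame_mul_diagonal_of_commute`
import Literature.NumberTheory.Rogawski1990.LocalEndoscopicScalarBlockPartnerCM            -- ★ `conj_mul_self_eq_one_of_local_one`, `conj_det_mul_det_eq_one_of_local_two`
import Literature.NumberTheory.Automorphic.LocalRegularOrbitClosed                         -- ★ `map_conjLocal_transpose_localForm`, `isUnit_det_localForm`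
import HarnessLib

/-!
# THE `Δ‴_v`-WEIGHTED CLASS COUNT VANISHES: `Σ_c Δ‴_v(γ_H, c) = 0` over the `G′_v`-classes at a `G`-regular `γ_H` of type (1) — and at every `G`-regular point
# of the torus through an `H`-regular `ε_H` (Rogawski 1990 §3.5 Prop. 3.5.2 (c), §4.3 (4.3.2), §4.9 Prop. 4.9.1; Labesse–Langlands 1979 §2)

Topic `NumberTheory/Rogawski1990`; namespace `Literature.NumberTheory.Rogawski1990`.  THEOREMS ONLY (no definition, no instance, no notation, no named fact, no `sorry`).
Cell `pub/hodgecm-mathlib` (D-0151), crux H413 = stmt-HodgeConjecture-24833, floor-2 line «N6nsGerm», stub `stub_N6nsS2`; LEAD F0P3a-plan (g9) WORD T8-149 (c′) «the `hΔ0` payer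
by ALL − GOOD», FILE A = (ALL).  The κ-orthogonality of ★ `LocalStableClassesNonsplitKappaCount` (`Σ_{c ⊂ 𝒪_st} κ_v(γ_H, out c) = 0`: `κ_v(γ_H, ·)` is a NON-TRIVIAL character of
`𝓔(T∕F_v) ≅ (ℤ∕2)²`) moved into the currency of the transfer junctions — the finsum over ALL of `ConjClasses G′_v` of the explicit factor `Δ‴_v = τ_v·D·κ_v` (★ `finExplicitDelta`),
which charges only the stable class of a match (★ `mk_mem_conjClassesIn_of_finExplicitDelta_ne_zero`) and is `τ_v(γ_H)·D(γ_H)` times `κ_v` there.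
* §1 **`finsum_finExplicitCollection_Δ_out_eq_zero_of_eigenframe`** — at a `G`-regular `γ_H` with a matched `t₁` carrying a type-(1) eigenframe (`t₁P₃ = P₃·diag(u′)`, `u′` injective,
  norm-one entries, `u′ j = γ(γ_H)`): the matched classes are FINITE and `Σᶠ_c Δ‴_v(γ_H, out c) = 0`.
* §2 **`finsum_finExplicitCollection_Δ_coe_out_eq_zero_of_torusFrame`** — the same at EVERY `G`-regular point `↑t` of the torus `Z_{H_v}(ε_H)` through an `H`-regular
  `ε_H = (A, u)` (`A·P = P·diag(dg)`, `dg 0 = u ≠ dg 1`: the (T) tokens of ★ `exists_torusTransport_frame` conjunct (8)); the frame of a matched `t₁ = g·ι(↑t)·g⁻¹` is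
  `g·ι(P, 1)` with entries `(d₀(t), u(t), d₁(t))` (★ `val_endoGL_frame_conj`), norm one by the Gram argument of ★ `exists_torusTransport_frame` (★ `norm_diag_eq_one_of_gram`),
  pairwise distinct by `G`-regularity.  No neighbourhood of the base point is needed.
Consumer: FILE B `LocalTransferTorusCompactSideKappaSumCM` (the `hΔ0` binder of ★ `exists_nhds_finsum_side_eq_zero_of_compact_dock` by ALL − GOOD).
HONEST LABEL: HC_CM is proved only modulo the printed citations (2 remaining named inputs hLiu418, h413) until rung 0 closes; this file is unconditional local algebra over ★ modules.

## References
* [Rogawski1990] J. D. Rogawski, *Automorphic Representations of Unitary Groups in Three Variables*, Ann. of Math. Stud. 123 (1990): §3.5 Prop. 3.5.2 (c) p. 29; §3.6 p. 31;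
  §4.3 (4.3.1)–(4.3.2) p. 43; §4.9 Prop. 4.9.1 p. 55; §8.2 Prop. 8.2.1 (c) pp. 113–115.
* [LabesseLanglands1979] J.-P. Labesse, R. P. Langlands, *L-indistinguishability for SL(2)*, Canad. J. Math. 31 (1979): §2.
-/

set_option autoImplicit false

noncomputable section

open Set Function Matrix Polynomial
open scoped MatrixGroups

namespace Literature.NumberTheory.Rogawski1990

open Literature.NumberTheory.Automorphic Literature.NumberTheory.Automorphic.UnitaryGroup Literature.NumberTheory.GaloisRepresentations
open Literature.AlgebraicGeometry.ShimuraVarieties (unitaryGroup mem_unitaryGroup_iff)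
open _root_.NumberField _root_.IsDedekindDomain

section KappaSum

variable (L : Type) [Field L] [NumberField L] [IsCMField L] (H' : Matrix (Fin 3) (Fin 3) L) (v : HeightOneSpectrum (𝓞 ↥(maximalRealSubfield L)))

/-- A CM field has a non-zero element negated by complex conjugation. [cite: Rogawski1990, §1.10] -/
private theorem exists_complexConj_eq_neg_ne_zero₈ : ∃ δ : L, IsCMField.complexConj L δ = -δ ∧ δ ≠ 0 := by
  obtain ⟨ζ, hζ⟩ := not_forall.1 fun h0 => IsCMField.complexConj_ne_one L (AlgEquiv.ext h0)
  refine ⟨ζ - IsCMField.complexConj L ζ, by rw [map_sub, IsCMField.complexConj_apply_apply, neg_sub], fun h0 => hζ ?_⟩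
  rw [sub_eq_zero] at h0
  exact h0.symm

/-! ## §1 At a `G`-regular point with a type-(1) eigenframe on a match -/

/-- **`Σᶠ_c Δ‴_v(γ_H, out c) = 0` OVER ALL `G′_v`-CLASSES** at a `G`-regular `γ_H` matched with some `t₁` of type (1) (eigenframe `t₁·P₃ = P₃·diag(u′)`, `u′` injective with
norm-one entries, `u′ j = γ(γ_H)`), together with the FINITENESS of the matched classes.  `Δ‴_v(γ_H, ·)` vanishes off the matches, the matched classes are the (four) classes of
the stable class of `t₁`, and there `Δ‴_v = τ_v(γ_H)·D(γ_H)·κ_v(γ_H, ·)` with `Σ κ_v = 0` (★ `finsum_mem_conjClassesIn_finKappaAt_out_eq_zero`).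
[cite: Rogawski1990, §3.5 Prop. 3.5.2 (c) p. 29; §4.3 (4.3.2) p. 43; §4.9 Prop. 4.9.1 p. 55] [cite: LabesseLanglands1979, §2] -/
theorem finsum_finExplicitCollection_Δ_out_eq_zero_of_eigenframe (w : PlacesOver L v) (hw : IsCMField.complexConj L • w.1 = w.1) (μ : HeckeCharacter L)
    (hl : ∀ (v : HeightOneSpectrum (𝓞 ↥(maximalRealSubfield L))) (a : ((cmDatum L 2 (Matrix.of fun i j : Fin 2 => if i.val + j.val + 1 = 2 then (1 : L) else 0)).Local v ×
      (cmDatum L 1 (Matrix.of fun i j : Fin 1 => if i.val + j.val + 1 = 1 then (1 : L) else 0)).Local v)) (b : (cmDatum L 3 H').Local v) (x : ((cmDatum L 2 (Matrix.of fun i j : Fin 2 => if i.val + j.val + 1 = 2 then (1 : L) else 0)).Local v ×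
      (cmDatum L 1 (Matrix.of fun i j : Fin 1 => if i.val + j.val + 1 = 1 then (1 : L) else 0)).Local v)),
      finExplicitDelta L v H' (x * a * x⁻¹) μ b = finExplicitDelta L v H' a μ b)
    (hr : ∀ (v : HeightOneSpectrum (𝓞 ↥(maximalRealSubfield L))) (a : ((cmDatum L 2 (Matrix.of fun i j : Fin 2 => if i.val + j.val + 1 = 2 then (1 : L) else 0)).Local v ×
      (cmDatum L 1 (Matrix.of fun i j : Fin 1 => if i.val + j.val + 1 = 1 then (1 : L) else 0)).Local v)) (b y : (cmDatum L 3 H').Local v),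
      finExplicitDelta L v H' a μ (y * b * y⁻¹) = finExplicitDelta L v H' a μ b)
    (hH' : (H'.map (cmConjRingHom L))ᵀ = H') (hdet' : H'.det ≠ 0)
    {a : ((cmDatum L 2 (Matrix.of fun i j : Fin 2 => if i.val + j.val + 1 = 2 then (1 : L) else 0)).Local v ×
      (cmDatum L 1 (Matrix.of fun i j : Fin 1 => if i.val + j.val + 1 = 1 then (1 : L) else 0)).Local v)} {t₁ : (cmDatum L 3 H').Local v} (h₁ : IsLocalNormPair L H' v a t₁) (hreg : IsLocalGRegular L v a)
    {P₃ : GL (Fin 3) (LocalRing L v)} {u' : Fin 3 → LocalRing L v}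
    (hP : (t₁.val.val : Matrix (Fin 3) (Fin 3) (LocalRing L v)) * P₃.val = P₃.val * diagonal u') (hu' : Function.Injective u')
    (hu'1 : ∀ i, conjLocal L (IsCMField.complexConj L) v (u' i) * u' i = 1) {j : Fin 3} (hj : u' j = finGammaTwo L v a) :
    {c : ConjClasses ((cmDatum L 3 H').Local v) | IsLocalNormPair L H' v a (Quotient.out c)}.Finite ∧
      ∑ᶠ c : ConjClasses ((cmDatum L 3 H').Local v), ((finExplicitCollection L H' μ hl hr) v).Δ a (Quotient.out c) = 0 := by
  classical
  have hH := map_conjLocal_transpose_localForm L 3 H' v hH'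
  have hHd := isUnit_det_localForm L 3 H' v hdet'
  have hu := isUnit_eval_finCharpolyTwo_of_isLocalGRegular L v a hreg
  obtain ⟨δ₁, hcδ, hδ⟩ := exists_complexConj_eq_neg_ne_zero₈ L
  have hSfin := finite_conjClassesIn_of_eigenframe L v (IsCMField.complexConj L) hcδ hδ w hw hH hHd t₁.2 hP hu' hu'1
  -- every class reads as `⟦out c⟧` on the ★ `unitaryGroup` carrier of ★ `conjClassesIn`
  have hmk : ∀ c : ConjClasses ((cmDatum L 3 H').Local v),
      ConjClasses.mk (⟨(Quotient.out c).val, (Quotient.out c).2⟩ : unitaryGroup (conjLocal L (IsCMField.complexConj L) v)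
        ((adelicForm L 3 H').map (adeleToLocal L v))) = c := fun c => Quotient.out_eq c
  -- the matched classes ARE the stable class of `t₁` (as sets of `G′_v`-classes)
  set S : Set (ConjClasses ((cmDatum L 3 H').Local v)) := {c : ConjClasses ((cmDatum L 3 H').Local v) | IsLocalNormPair L H' v a (Quotient.out c)} with hSdef
  have hSeq : S = (conjClassesIn (conjLocal L (IsCMField.complexConj L) v) ((adelicForm L 3 H').map (adeleToLocal L v)) ⟨t₁.val, t₁.2⟩ :
      Set (ConjClasses ((cmDatum L 3 H').Local v))) := by
    ext c
    refine ⟨fun hc => ?_, fun hc => ?_⟩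
    · have h := mk_mem_conjClassesIn_of_isLocalNormPair L v H' a h₁ hc
      rwa [hmk] at h
    · exact isLocalNormPair_of_mk_mem_conjClassesIn L v H' a t₁ h₁ (by rw [hmk]; exact hc)
  have hSfin' : S.Finite := by rw [hSeq]; exact hSfin
  refine ⟨hSfin', ?_⟩
  set F : ConjClasses ((cmDatum L 3 H').Local v) → ℂ := fun c => ((finExplicitCollection L H' μ hl hr) v).Δ a (Quotient.out c) with hF
  -- support inside the matched classes
  have hsupp : Function.support F ⊆ S := by
    intro c hc
    rw [Function.mem_support] at hc
    by_contra hn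
    apply hc
    simp only [hF, finExplicitCollection_Δ, finExplicitDelta_of_not_isLocalNormPair L v H' a μ hn]
  rw [← finsum_mem_univ, finsum_mem_inter_support_eq' F Set.univ S (fun x hx => ⟨fun _ => hsupp hx, fun _ => Set.mem_univ _⟩)]
  -- on the matched classes `Δ‴ = (τ·D) · κ`
  have hval : ∀ c ∈ S, F c = (finTau L v a μ * (finWeylRatio L v a : ℂ)) * (Int.castAddHom ℂ) (finKappaAt L v H' a (Quotient.out c)) := by
    intro c hc
    have hm : IsLocalNormPair L H' v a (Quotient.out c) := hc
    simp only [hF]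
    rw [finExplicitCollection_Δ, finExplicitDelta_of_isLocalNormPair L v H' a μ hm, Int.coe_castAddHom]
  -- `Σ_{c ⊂ 𝒪_st(t₁)} κ_v = 0` (★), read on the `G′_v`-classes
  have hκ0 : ∑ᶠ c ∈ S, finKappaAt L v H' a (Quotient.out c) = 0 := by
    rw [hSeq]
    exact finsum_mem_conjClassesIn_finKappaAt_out_eq_zero L v H' a t₁ w hw h₁ hu hH hHd hP hu' hu'1 hj
  rw [finsum_mem_congr rfl hval, ← mul_finsum_mem' _ _ hSfin', ← AddMonoidHom.map_finsum_mem _ _ hSfin', hκ0, map_zero, mul_zero]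

/-! ## §2 At every `G`-regular point of the torus through an `H`-regular `ε_H` -/

set_option maxHeartbeats 400000 in
/-- **`Σᶠ_c Δ‴_v(↑t, out c) = 0` AT EVERY `G`-REGULAR POINT `t` OF THE TORUS `Z_{H_v}(ε_H)`**, `ε_H = (A, u)` with `A` `H`-regular: `A·P = P·diag(dg)`, `dg 0 = u`,
`dg 0 ≠ dg 1` (the (T) tokens of ★ `exists_torusTransport_frame` (8)); the matched classes are finite.  Every `t ∈ Z_{H_v}(ε_H)` is `P`-diagonal with NORM-ONE entries
(the Gram matrix of `P` for `Φ₂` is diagonal and non-degenerate since `u = dg 0` and `dg 1 = det A ∕ dg 0` are norm one and distinct — ★ `gram_offDiag_eq_zero`,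
★ `norm_diag_eq_one_of_gram`), so a match `t₁ = g·ι(↑t)·g⁻¹` has the type-(1) eigenframe `g·ι(P,1)` with entries `(d₀(t), u(t), d₁(t))` (★ `val_endoGL_frame_conj`), pairwise
distinct when `ι(↑t)` is regular; §1 applies.  If nothing is matched the sum is empty. [cite: Rogawski1990, §3.6 p. 31; §4.3 (4.3.2) p. 43; §8.2 Prop. 8.2.1 (c) pp. 113–115] -/
theorem finsum_finExplicitCollection_Δ_coe_out_eq_zero_of_torusFrame (w : PlacesOver L v) (hw : IsCMField.complexConj L • w.1 = w.1) (μ : HeckeCharacter L)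
    (hl : ∀ (v : HeightOneSpectrum (𝓞 ↥(maximalRealSubfield L))) (a : ((cmDatum L 2 (Matrix.of fun i j : Fin 2 => if i.val + j.val + 1 = 2 then (1 : L) else 0)).Local v ×
      (cmDatum L 1 (Matrix.of fun i j : Fin 1 => if i.val + j.val + 1 = 1 then (1 : L) else 0)).Local v)) (b : (cmDatum L 3 H').Local v) (x : ((cmDatum L 2 (Matrix.of fun i j : Fin 2 => if i.val + j.val + 1 = 2 then (1 : L) else 0)).Local v ×
      (cmDatum L 1 (Matrix.of fun i j : Fin 1 => if i.val + j.val + 1 = 1 then (1 : L) else 0)).Local v)),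
      finExplicitDelta L v H' (x * a * x⁻¹) μ b = finExplicitDelta L v H' a μ b)
    (hr : ∀ (v : HeightOneSpectrum (𝓞 ↥(maximalRealSubfield L))) (a : ((cmDatum L 2 (Matrix.of fun i j : Fin 2 => if i.val + j.val + 1 = 2 then (1 : L) else 0)).Local v ×
      (cmDatum L 1 (Matrix.of fun i j : Fin 1 => if i.val + j.val + 1 = 1 then (1 : L) else 0)).Local v)) (b y : (cmDatum L 3 H').Local v),
      finExplicitDelta L v H' a μ (y * b * y⁻¹) = finExplicitDelta L v H' a μ b)
    (hH' : (H'.map (cmConjRingHom L))ᵀ = H') (hdet' : H'.det ≠ 0)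
    (εH : ((cmDatum L 2 (Matrix.of fun i j : Fin 2 => if i.val + j.val + 1 = 2 then (1 : L) else 0)).Local v ×
      (cmDatum L 1 (Matrix.of fun i j : Fin 1 => if i.val + j.val + 1 = 1 then (1 : L) else 0)).Local v))
    {P : GL (Fin 2) (LocalRing L v)} {dg : Fin 2 → LocalRing L v}
    (hP : (εH.1.val.val : Matrix (Fin 2) (Fin 2) (LocalRing L v)) * P.val = P.val * diagonal dg) (hdg0 : dg 0 = finGammaTwo L v εH) (hdg01 : dg 0 ≠ dg 1)
    (t : ↥(Subgroup.centralizer ({εH} : Set ((cmDatum L 2 (Matrix.of fun i j : Fin 2 => if i.val + j.val + 1 = 2 then (1 : L) else 0)).Local v ×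
      (cmDatum L 1 (Matrix.of fun i j : Fin 1 => if i.val + j.val + 1 = 1 then (1 : L) else 0)).Local v))))
    (hreg : IsLocalGRegular L v (t : ((cmDatum L 2 (Matrix.of fun i j : Fin 2 => if i.val + j.val + 1 = 2 then (1 : L) else 0)).Local v ×
      (cmDatum L 1 (Matrix.of fun i j : Fin 1 => if i.val + j.val + 1 = 1 then (1 : L) else 0)).Local v))) :
    {c : ConjClasses ((cmDatum L 3 H').Local v) | IsLocalNormPair L H' v (t : ((cmDatum L 2 (Matrix.of fun i j : Fin 2 => if i.val + j.val + 1 = 2 then (1 : L) else 0)).Local v ×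
      (cmDatum L 1 (Matrix.of fun i j : Fin 1 => if i.val + j.val + 1 = 1 then (1 : L) else 0)).Local v)) (Quotient.out c)}.Finite ∧
      ∑ᶠ c : ConjClasses ((cmDatum L 3 H').Local v), ((finExplicitCollection L H' μ hl hr) v).Δ (t : ((cmDatum L 2 (Matrix.of fun i j : Fin 2 => if i.val + j.val + 1 = 2 then (1 : L) else 0)).Local v ×
      (cmDatum L 1 (Matrix.of fun i j : Fin 1 => if i.val + j.val + 1 = 1 then (1 : L) else 0)).Local v)) (Quotient.out c) = 0 := by
  classical
  -- no match ⇒ nothing to sum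
  by_cases hex : ∃ t₁ : (cmDatum L 3 H').Local v, IsLocalNormPair L H' v (t : ((cmDatum L 2 (Matrix.of fun i j : Fin 2 => if i.val + j.val + 1 = 2 then (1 : L) else 0)).Local v ×
      (cmDatum L 1 (Matrix.of fun i j : Fin 1 => if i.val + j.val + 1 = 1 then (1 : L) else 0)).Local v)) t₁
  swap
  · have hnone : ∀ c : ConjClasses ((cmDatum L 3 H').Local v), ¬ IsLocalNormPair L H' v (t : ((cmDatum L 2 (Matrix.of fun i j : Fin 2 => if i.val + j.val + 1 = 2 then (1 : L) else 0)).Local v ×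
      (cmDatum L 1 (Matrix.of fun i j : Fin 1 => if i.val + j.val + 1 = 1 then (1 : L) else 0)).Local v)) (Quotient.out c) := fun c hc => hex ⟨_, hc⟩
    refine ⟨?_, ?_⟩
    · convert Set.finite_empty
      ext c
      simp only [Set.mem_setOf_eq, Set.mem_empty_iff_false, iff_false]
      exact hnone c
    · refine finsum_eq_zero_of_forall_eq_zero fun c => ?_
      rw [finExplicitCollection_Δ, finExplicitDelta_of_not_isLocalNormPair L v H' _ μ (hnone c)]
  obtain ⟨t₁, h₁⟩ := hex
  have hc1 : IsCMField.complexConj L ≠ 1 := IsCMField.complexConj_ne_one L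
  letI : Field (LocalRing L v) := (LocalRing.isField_of_smul_eq (IsCMField.complexConj L) hc1 w hw).toField
  -- the base matrix `A = εH.1`: unitary, `P`-diagonal with norm-one distinct eigenvalues `dg`
  obtain ⟨A, hAdef⟩ : ∃ A : Matrix (Fin 2) (Fin 2) (LocalRing L v), A = εH.1.val.val := ⟨_, rfl⟩
  have hAU : (A.map (conjLocal L (IsCMField.complexConj L) v))ᵀ * ((adelicForm L 2 (Matrix.of fun i j : Fin 2 => if i.val + j.val + 1 = 2 then (1 : L) else 0)).map (adeleToLocal L v)) * A = ((adelicForm L 2 (Matrix.of fun i j : Fin 2 => if i.val + j.val + 1 = 2 then (1 : L) else 0)).map (adeleToLocal L v)) := by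
    rw [hAdef]; exact mem_unitaryGroupOfForm_iff.1 εH.1.2
  rw [← hAdef] at hP
  have hu1 : (conjLocal L (IsCMField.complexConj L) v) (finGammaTwo L v εH) * finGammaTwo L v εH = 1 := conj_mul_self_eq_one_of_local_one L v εH.2
  have hPP' : P.val * P⁻¹.val = 1 := by rw [← Units.val_mul, mul_inv_cancel, Units.val_one]
  have hAconj : A = P.val * diagonal dg * P⁻¹.val := by
    calc A = A * (P.val * P⁻¹.val) := by rw [hPP', Matrix.mul_one]
      _ = P.val * diagonal dg * P⁻¹.val := by rw [← Matrix.mul_assoc, hP]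
  have hdetA : A.det = dg 0 * dg 1 := by
    rw [hAconj, Matrix.det_units_conj, det_diagonal, Fin.prod_univ_two]
  have hd11 : (conjLocal L (IsCMField.complexConj L) v) (dg 1) * dg 1 = 1 := by
    have h := conj_det_mul_det_eq_one_of_local_two L v εH.1
    rw [← hAdef, hdetA, map_mul, hdg0] at h
    calc (conjLocal L (IsCMField.complexConj L) v) (dg 1) * dg 1
        = ((conjLocal L (IsCMField.complexConj L) v) (dg 1) * dg 1) * ((conjLocal L (IsCMField.complexConj L) v) (finGammaTwo L v εH) * finGammaTwo L v εH) := by rw [hu1, mul_one]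
      _ = (conjLocal L (IsCMField.complexConj L) v) (finGammaTwo L v εH) * (conjLocal L (IsCMField.complexConj L) v) (dg 1) * (finGammaTwo L v εH * dg 1) := by ring
      _ = 1 := h
  have hd00 : (conjLocal L (IsCMField.complexConj L) v) (dg 0) * dg 0 = 1 := by rw [hdg0]; exact hu1
  have hnorm : ∀ i, (conjLocal L (IsCMField.complexConj L) v) (dg i) * dg i = 1 := fun i => by fin_cases i <;> assumption
  have hdinj : Function.Injective dg := fun i k hik => by
    fin_cases i <;> fin_cases k
    · rfl
    · exact absurd hik hdg01
    · exact absurd hik.symm hdg01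
    · rfl
  have hcross : ∀ i k, i ≠ k → (conjLocal L (IsCMField.complexConj L) v) (dg i) * dg k ≠ 1 := by
    intro i k hik h
    apply hik
    apply hdinj
    calc dg i = dg i * ((conjLocal L (IsCMField.complexConj L) v) (dg i) * dg k) := by rw [h, mul_one]
      _ = ((conjLocal L (IsCMField.complexConj L) v) (dg i) * dg i) * dg k := by ring
      _ = dg k := by rw [hnorm i, one_mul]
  -- the Gram matrix of the frame `P` is diagonal with non-zero diagonal
  obtain ⟨hG01, hG10⟩ := gram_offDiag_eq_zero (conjLocal L (IsCMField.complexConj L) v) _ hAU hP (hcross 0 1 (by decide)) (hcross 1 0 (by decide))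
  have hGdet : ((P.val.map (conjLocal L (IsCMField.complexConj L) v))ᵀ * ((adelicForm L 2 (Matrix.of fun i j : Fin 2 => if i.val + j.val + 1 = 2 then (1 : L) else 0)).map (adeleToLocal L v)) * P.val).det ≠ 0 := by
    rw [det_mul, det_mul, det_transpose, ← RingHom.mapMatrix_apply, ← RingHom.map_det]
    refine mul_ne_zero (mul_ne_zero ?_ (isUnit_det_adelicForm_antidiagTwo_local L v).ne_zero) ?_
    · exact (_root_.map_ne_zero _).2 (Matrix.isUnits_det_units P).ne_zero
    · exact (Matrix.isUnits_det_units P).ne_zero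
  have hGii : ∀ i : Fin 2, ((P.val.map (conjLocal L (IsCMField.complexConj L) v))ᵀ * ((adelicForm L 2 (Matrix.of fun i j : Fin 2 => if i.val + j.val + 1 = 2 then (1 : L) else 0)).map (adeleToLocal L v)) * P.val) i i ≠ 0 := by
    rw [det_fin_two, hG01, hG10, mul_zero, sub_zero] at hGdet
    intro i; fin_cases i
    · exact left_ne_zero_of_mul hGdet
    · exact right_ne_zero_of_mul hGdet
  -- `t.1` commutes with `A`, hence is `P`-diagonal, with norm-one entries
  have hcomm : (t.1.1.val.val : Matrix (Fin 2) (Fin 2) (LocalRing L v)) * A = A * t.1.1.val.val := by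
    have ht := Subgroup.mem_centralizer_singleton_iff.1 t.2
    have h1 := congrArg (fun z : ((cmDatum L 2 (Matrix.of fun i j : Fin 2 => if i.val + j.val + 1 = 2 then (1 : L) else 0)).Local v ×
      (cmDatum L 1 (Matrix.of fun i j : Fin 1 => if i.val + j.val + 1 = 1 then (1 : L) else 0)).Local v) => (z.1.val.val : Matrix (Fin 2) (Fin 2) (LocalRing L v))) ht
    rw [hAdef]; exact h1
  have hframe : (t.1.1.val.val : Matrix (Fin 2) (Fin 2) (LocalRing L v)) * P.val =
      P.val * diagonal ![(P⁻¹.val * t.1.1.val.val * P.val) 0 0, (P⁻¹.val * t.1.1.val.val * P.val) 1 1] :=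
    mul_frame_eq_frame_mul_diagonal_of_commute P hP hdg01 hcomm
  have hmemU : ((t.1.1.val.val : Matrix (Fin 2) (Fin 2) (LocalRing L v)).map (conjLocal L (IsCMField.complexConj L) v))ᵀ * ((adelicForm L 2 (Matrix.of fun i j : Fin 2 => if i.val + j.val + 1 = 2 then (1 : L) else 0)).map (adeleToLocal L v)) * t.1.1.val.val = ((adelicForm L 2 (Matrix.of fun i j : Fin 2 => if i.val + j.val + 1 = 2 then (1 : L) else 0)).map (adeleToLocal L v)) :=
    mem_unitaryGroupOfForm_iff.1 t.1.1.2
  have hα1 : (conjLocal L (IsCMField.complexConj L) v) ((P⁻¹.val * t.1.1.val.val * P.val) 0 0) * (P⁻¹.val * t.1.1.val.val * P.val) 0 0 = 1 :=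
    norm_diag_eq_one_of_gram (conjLocal L (IsCMField.complexConj L) v) _ hmemU hframe 0 (hGii 0)
  have hβ1 : (conjLocal L (IsCMField.complexConj L) v) ((P⁻¹.val * t.1.1.val.val * P.val) 1 1) * (P⁻¹.val * t.1.1.val.val * P.val) 1 1 = 1 :=
    norm_diag_eq_one_of_gram (conjLocal L (IsCMField.complexConj L) v) _ hmemU hframe 1 (hGii 1)
  have hγ1 : (conjLocal L (IsCMField.complexConj L) v) (finGammaTwo L v (t : ((cmDatum L 2 (Matrix.of fun i j : Fin 2 => if i.val + j.val + 1 = 2 then (1 : L) else 0)).Local v ×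
      (cmDatum L 1 (Matrix.of fun i j : Fin 1 => if i.val + j.val + 1 = 1 then (1 : L) else 0)).Local v))) * finGammaTwo L v (t : ((cmDatum L 2 (Matrix.of fun i j : Fin 2 => if i.val + j.val + 1 = 2 then (1 : L) else 0)).Local v ×
      (cmDatum L 1 (Matrix.of fun i j : Fin 1 => if i.val + j.val + 1 = 1 then (1 : L) else 0)).Local v)) = 1 :=
    conj_mul_self_eq_one_of_local_one L v t.1.2
  -- the 3 × 3 frame of `ι(↑t)`: `ι(P, 1)`, entries `(d₀, u, d₁)`
  obtain ⟨d₀, hd₀⟩ : ∃ d₀ : LocalRing L v, d₀ = (P⁻¹.val * t.1.1.val.val * P.val) 0 0 := ⟨_, rfl⟩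
  obtain ⟨d₁, hd₁⟩ : ∃ d₁ : LocalRing L v, d₁ = (P⁻¹.val * t.1.1.val.val * P.val) 1 1 := ⟨_, rfl⟩
  rw [← hd₀] at hframe hα1
  rw [← hd₁] at hframe hβ1
  have hιval : ((endoEmbLocal L v (t : ((cmDatum L 2 (Matrix.of fun i j : Fin 2 => if i.val + j.val + 1 = 2 then (1 : L) else 0)).Local v ×
      (cmDatum L 1 (Matrix.of fun i j : Fin 1 => if i.val + j.val + 1 = 1 then (1 : L) else 0)).Local v))).val : GL (Fin 3) (LocalRing L v)) = endoGL (t.1.1.val, t.1.2.val) := coe_endoEmbLocal L v _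
  have hdiag3 : (!![d₀, 0, 0; 0, (t.1.2.val.val : Matrix (Fin 1) (Fin 1) (LocalRing L v)) 0 0, 0; 0, 0, d₁] : Matrix (Fin 3) (Fin 3) (LocalRing L v)) =
      diagonal ![d₀, finGammaTwo L v (t : ((cmDatum L 2 (Matrix.of fun i j : Fin 2 => if i.val + j.val + 1 = 2 then (1 : L) else 0)).Local v ×
      (cmDatum L 1 (Matrix.of fun i j : Fin 1 => if i.val + j.val + 1 = 1 then (1 : L) else 0)).Local v)), d₁] := by
    ext i k; fin_cases i <;> fin_cases k <;> rfl
  have hιframe : (((endoEmbLocal L v (t : ((cmDatum L 2 (Matrix.of fun i j : Fin 2 => if i.val + j.val + 1 = 2 then (1 : L) else 0)).Local v ×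
      (cmDatum L 1 (Matrix.of fun i j : Fin 1 => if i.val + j.val + 1 = 1 then (1 : L) else 0)).Local v))).val : GL (Fin 3) (LocalRing L v)).val : Matrix (Fin 3) (Fin 3) (LocalRing L v)) *
        (endoGL (P, (1 : GL (Fin 1) (LocalRing L v)))).val =
      (endoGL (P, (1 : GL (Fin 1) (LocalRing L v)))).val * diagonal ![d₀, finGammaTwo L v (t : ((cmDatum L 2 (Matrix.of fun i j : Fin 2 => if i.val + j.val + 1 = 2 then (1 : L) else 0)).Local v ×
      (cmDatum L 1 (Matrix.of fun i j : Fin 1 => if i.val + j.val + 1 = 1 then (1 : L) else 0)).Local v)), d₁] := by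
    have h := val_endoGL_frame_conj P t.1.1.val t.1.2.val hframe
    rw [hιval, ← hdiag3, ← h, ← Units.val_mul, ← Units.val_mul]
    congr 1
    group
  -- the match `t₁ = g ι(↑t) g⁻¹` and its frame `g·ι(P, 1)`
  obtain ⟨g, hg⟩ := isConj_iff.1 ((isLocalNormPair_iff (L := L) (H' := H') (v := v) _ _).1 h₁)
  have ht₁frame : (t₁.val.val : Matrix (Fin 3) (Fin 3) (LocalRing L v)) * (g * endoGL (P, (1 : GL (Fin 1) (LocalRing L v)))).val =
      (g * endoGL (P, (1 : GL (Fin 1) (LocalRing L v)))).val * diagonal ![d₀, finGammaTwo L v (t : ((cmDatum L 2 (Matrix.of fun i j : Fin 2 => if i.val + j.val + 1 = 2 then (1 : L) else 0)).Local v ×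
      (cmDatum L 1 (Matrix.of fun i j : Fin 1 => if i.val + j.val + 1 = 1 then (1 : L) else 0)).Local v)), d₁] := by
    have hg' : ((t₁.val : GL (Fin 3) (LocalRing L v)).val : Matrix (Fin 3) (Fin 3) (LocalRing L v)) =
        g.val * (((endoEmbLocal L v (t : ((cmDatum L 2 (Matrix.of fun i j : Fin 2 => if i.val + j.val + 1 = 2 then (1 : L) else 0)).Local v ×
      (cmDatum L 1 (Matrix.of fun i j : Fin 1 => if i.val + j.val + 1 = 1 then (1 : L) else 0)).Local v))).val : GL (Fin 3) (LocalRing L v)).val : Matrix (Fin 3) (Fin 3) (LocalRing L v)) * (g⁻¹).val := by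
      rw [← Units.val_mul, ← Units.val_mul, hg]
    calc (t₁.val.val : Matrix (Fin 3) (Fin 3) (LocalRing L v)) * (g * endoGL (P, (1 : GL (Fin 1) (LocalRing L v)))).val
        = g.val * ((((endoEmbLocal L v (t : ((cmDatum L 2 (Matrix.of fun i j : Fin 2 => if i.val + j.val + 1 = 2 then (1 : L) else 0)).Local v ×
      (cmDatum L 1 (Matrix.of fun i j : Fin 1 => if i.val + j.val + 1 = 1 then (1 : L) else 0)).Local v))).val : GL (Fin 3) (LocalRing L v)).val : Matrix (Fin 3) (Fin 3) (LocalRing L v)) *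
            ((g⁻¹).val * g.val) * (endoGL (P, (1 : GL (Fin 1) (LocalRing L v)))).val) := by
          rw [show (t₁.val.val : Matrix (Fin 3) (Fin 3) (LocalRing L v)) = ((t₁.val : GL (Fin 3) (LocalRing L v)).val : Matrix (Fin 3) (Fin 3) (LocalRing L v)) from rfl,
            hg', Units.val_mul]
          simp only [Matrix.mul_assoc]
      _ = g.val * ((endoGL (P, (1 : GL (Fin 1) (LocalRing L v)))).val * diagonal ![d₀, finGammaTwo L v (t : ((cmDatum L 2 (Matrix.of fun i j : Fin 2 => if i.val + j.val + 1 = 2 then (1 : L) else 0)).Local v ×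
      (cmDatum L 1 (Matrix.of fun i j : Fin 1 => if i.val + j.val + 1 = 1 then (1 : L) else 0)).Local v)), d₁]) := by
          rw [← Units.val_mul, inv_mul_cancel, Units.val_one, Matrix.mul_one, hιframe]
      _ = (g * endoGL (P, (1 : GL (Fin 1) (LocalRing L v)))).val * diagonal ![d₀, finGammaTwo L v (t : ((cmDatum L 2 (Matrix.of fun i j : Fin 2 => if i.val + j.val + 1 = 2 then (1 : L) else 0)).Local v ×
      (cmDatum L 1 (Matrix.of fun i j : Fin 1 => if i.val + j.val + 1 = 1 then (1 : L) else 0)).Local v)), d₁] := by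
          rw [Units.val_mul, Matrix.mul_assoc]
  -- injectivity of the entries from `G`-regularity
  have hu : IsUnit ((finCharpolyTwo L v (t : ((cmDatum L 2 (Matrix.of fun i j : Fin 2 => if i.val + j.val + 1 = 2 then (1 : L) else 0)).Local v ×
      (cmDatum L 1 (Matrix.of fun i j : Fin 1 => if i.val + j.val + 1 = 1 then (1 : L) else 0)).Local v))).eval (finGammaTwo L v (t : ((cmDatum L 2 (Matrix.of fun i j : Fin 2 => if i.val + j.val + 1 = 2 then (1 : L) else 0)).Local v ×
      (cmDatum L 1 (Matrix.of fun i j : Fin 1 => if i.val + j.val + 1 = 1 then (1 : L) else 0)).Local v)))) := isUnit_eval_finCharpolyTwo_of_isLocalGRegular L v _ hreg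
  have heval := eval_finCharpolyTwo_eq_of_frame P hframe
  have hne0 : finGammaTwo L v (t : ((cmDatum L 2 (Matrix.of fun i j : Fin 2 => if i.val + j.val + 1 = 2 then (1 : L) else 0)).Local v ×
      (cmDatum L 1 (Matrix.of fun i j : Fin 1 => if i.val + j.val + 1 = 1 then (1 : L) else 0)).Local v)) ≠ d₀ := by
    intro h; rw [heval, h, sub_self, zero_mul] at hu; exact not_isUnit_zero hu
  have hne1 : finGammaTwo L v (t : ((cmDatum L 2 (Matrix.of fun i j : Fin 2 => if i.val + j.val + 1 = 2 then (1 : L) else 0)).Local v ×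
      (cmDatum L 1 (Matrix.of fun i j : Fin 1 => if i.val + j.val + 1 = 1 then (1 : L) else 0)).Local v)) ≠ d₁ := by
    intro h; rw [heval, h, sub_self, mul_zero] at hu; exact not_isUnit_zero hu
  have h01 : d₀ ≠ d₁ := by
    intro h
    have hsep := IsLocalGRegular.separable_finCharpolyTwo L v hreg
    rw [finCharpolyTwo_eq_of_frame P hframe, h] at hsep
    exact Polynomial.not_isUnit_X_sub_C d₁ (isCoprime_self.1 hsep.isCoprime)
  have hinj : Function.Injective (![d₀, finGammaTwo L v (t : ((cmDatum L 2 (Matrix.of fun i j : Fin 2 => if i.val + j.val + 1 = 2 then (1 : L) else 0)).Local v ×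
      (cmDatum L 1 (Matrix.of fun i j : Fin 1 => if i.val + j.val + 1 = 1 then (1 : L) else 0)).Local v)), d₁] : Fin 3 → LocalRing L v) := by
    intro i k hik
    fin_cases i <;> fin_cases k <;> simp at hik <;>
      first
      | rfl
      | exact absurd hik hne0.symm
      | exact absurd hik hne0
      | exact absurd hik h01
      | exact absurd hik h01.symm
      | exact absurd hik hne1
      | exact absurd hik hne1.symm
  have hu'1 : ∀ i, conjLocal L (IsCMField.complexConj L) v ((![d₀, finGammaTwo L v (t : ((cmDatum L 2 (Matrix.of fun i j : Fin 2 => if i.val + j.val + 1 = 2 then (1 : L) else 0)).Local v ×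
      (cmDatum L 1 (Matrix.of fun i j : Fin 1 => if i.val + j.val + 1 = 1 then (1 : L) else 0)).Local v)), d₁] : Fin 3 → LocalRing L v) i) *
      (![d₀, finGammaTwo L v (t : ((cmDatum L 2 (Matrix.of fun i j : Fin 2 => if i.val + j.val + 1 = 2 then (1 : L) else 0)).Local v ×
      (cmDatum L 1 (Matrix.of fun i j : Fin 1 => if i.val + j.val + 1 = 1 then (1 : L) else 0)).Local v)), d₁] : Fin 3 → LocalRing L v) i = 1 := by
    intro i; fin_cases i
    · exact hα1
    · exact hγ1
    · exact hβ1
  have hj : (![d₀, finGammaTwo L v (t : ((cmDatum L 2 (Matrix.of fun i j : Fin 2 => if i.val + j.val + 1 = 2 then (1 : L) else 0)).Local v ×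
      (cmDatum L 1 (Matrix.of fun i j : Fin 1 => if i.val + j.val + 1 = 1 then (1 : L) else 0)).Local v)), d₁] : Fin 3 → LocalRing L v) 1 = finGammaTwo L v (t : ((cmDatum L 2 (Matrix.of fun i j : Fin 2 => if i.val + j.val + 1 = 2 then (1 : L) else 0)).Local v ×
      (cmDatum L 1 (Matrix.of fun i j : Fin 1 => if i.val + j.val + 1 = 1 then (1 : L) else 0)).Local v)) := rfl
  exact finsum_finExplicitCollection_Δ_out_eq_zero_of_eigenframe L H' v w hw μ hl hr hH' hdet' h₁ hreg ht₁frame hinj hu'1 hj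

end KappaSum

end Literature.NumberTheory.Rogawski1990

end
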